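/-
Copyright (c) 2026 the pub-hodgecm-mathlib formalisation cell (harness21).  Prover seat hodgecm-mathlib-K2E3-p03 (g11), Track B «K2-LIT»,
hLiu418 = `stmt-HodgeConjecture-24832`; K1a (C-K) desk K2E4-p10 (g11), LEAD F0P6-plan (g16) BATCH #297 (3) ∕ #299 (3): (C-K-3)(L) FILE A2 —
THE EULER CALCULUS OF SHIMURA's ξ-INTEGRAND ON THE CHART OF `Herm₂(ℂ)`: the radial field in coordinates, homogeneity of `det`, coordinate bounds,
the divisor `(x₀₀ + ip)⁻¹`, and the line derivative of the full integrand with its relative bound.  THEOREMS ONLY (no `def`, no `instance`, no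
notation, no named-fact hypothesis, no `sorry`); lane `--supports stmt-HodgeConjecture-24832 --as helper`.
-/
import Summits.HodgeConjecture.HodgeConjecture.Theorems.K2LiuHermTwoXiCayleyRecursion        -- ★ ⊇ `hasLineDerivAt_xiTwoIntegrand_zero`, entry bounds, direction matrices
import Summits.HodgeConjecture.HodgeConjecture.Theorems.K2LiuHermTwoConfluentXiRegularity     -- ★ `det_le_norm_det_add_I_smul`, `det_re_pos_of_posDef`
import HarnessLib

/-!
# Crux `HLiu418`, K1-a♮ (C-K-3)(L) FILE A2: the EULER CALCULUS of the ξ-integrand on the chart `ℝ × ℂ × ℝ ≅ Herm₂(ℂ)`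

Cell `hodgecm-mathlib`, crux item hLiu418 = `stmt-HodgeConjecture-24832` (helper lane `--supports … --as helper`, count-neutral), route of record
`HCCMUnconditional`; squad K2 ∕ K2Liu.  Second of three files proving the CROSSING LEMMA (census `K2/K2E3-p03/g11/CENSUS-CK3-L-crossing.md`): the
pointwise algebra and calculus that FILE A3's Euler integration by parts `∫ x·∇(W·Φ·D) = −4∫ W·Φ·D` consumes.
* §1 `hermTwo_decomp`, `trace_mul_hermTwo_decomp`, `coord_decomp` — the radial field `x·∇ = a∂_a + re z ∂_u + im z ∂_v + b∂_b` in the four Lebesgue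
  directions `E_a, E_u, E_v, E_b` of ★ `K2LiuHermTwoXiIntegrandCayley`; **homogeneity of `det`**: `tr(adj(g − ix)·x) = −i·(tr(adj(g − ix)·g) − 2det(g − ix))`
  and `tr(adj(g + ix)·x) = −i·(2det(g + ix) − tr(adj(g + ix)·g))` (so `x·∇` of `det(g ± ix)^{−γ}` has BOUNDED coefficients); the rank-one phase
  `tr(hermTwo(t,0,0)·x) = t·x₀₀`; the coordinate bound `‖x_{kl}‖ ≤ Cx·|det(g + ix)|` (★ `exists_norm_entry_le_add`, ★ `det_le_norm_det_add_I_smul`);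
  the divisor `D = (x₀₀ + ip)⁻¹`: `‖D‖ = (x₀₀² + p²)^{−1/2}`, `‖D‖ ≤ 1∕p`, `x₀₀·D = 1 − ip·D`, `‖x₀₀D‖ ≤ 1`, `D_v D = −v₁·D²`.
* §2 `hasLineDerivAt_xiTwoIntegrand` — the line derivative of the FULL integrand (character included):
  `D_v ξ-int(α,β) = −2πi·tr(h·E_v)·ξ-int(α,β) − iα·tr(adj(g−ix)E_v)·ξ-int(α+1,β) + iβ·tr(adj(g+ix)E_v)·ξ-int(α,β+1)` (★ `hasLineDerivAt_cexp_trace`,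
  ★ `hasLineDerivAt_xiTwoIntegrand_zero`), and `exists_norm_lineDeriv_xiTwoIntegrand_le`: `‖D_v ξ-int(α,β)(x)‖ ≤ CΦ·‖ξ-int(α,β)(x)‖` uniformly in `x`.
References: [Shimura1982, §1 (1.25), §3]; [Shimura1997, §16.4–16.5]; [FarautKoranyi1994, Ch. VII §1].
HONEST LABEL.  Count-neutral helper; closes no socket: HC_CM is proved only modulo the 7 printed citations (2 remaining named inputs:
hLiu418 = `stmt-HodgeConjecture-24832`, h413 = `stmt-HodgeConjecture-24833`) until rung 0 closes.
-/

set_option autoImplicit false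
-- the mandated namespace repeats the single-problem summit's segment (`HodgeConjecture.HodgeConjecture`)
set_option linter.dupNamespace false

noncomputable section

open Complex MeasureTheory Set Metric
open scoped ComplexOrder ComplexConjugate

namespace Summit.HodgeConjecture.HodgeConjecture.Cruxes.HLiu418.K2LiuHermTwoXiEulerCalculus

open Summit.HodgeConjecture.HodgeConjecture.Cruxes.HLiu418.K2LiuHermTwoGammaDefs
open Summit.HodgeConjecture.HodgeConjecture.Cruxes.HLiu418.K2LiuHermTwoDetPowerIntegrable
open Summit.HodgeConjecture.HodgeConjecture.Cruxes.HLiu418.K2LiuHermTwoConfluentXiDefs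
open Summit.HodgeConjecture.HodgeConjecture.Cruxes.HLiu418.K2LiuHermTwoConfluentXiConvergence
open Summit.HodgeConjecture.HodgeConjecture.Cruxes.HLiu418.K2LiuHermTwoConfluentXiRegularity
open Summit.HodgeConjecture.HodgeConjecture.Cruxes.HLiu418.K2LiuHermTwoEtaDefs
open Summit.HodgeConjecture.HodgeConjecture.Cruxes.HLiu418.K2LiuHermTwoXiIntegrandLineDeriv
open Summit.HodgeConjecture.HodgeConjecture.Cruxes.HLiu418.K2LiuHermTwoXiIntegrandCayley
open Summit.HodgeConjecture.HodgeConjecture.Cruxes.HLiu418.K2LiuHermTwoXiCayleyIntegrability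

/-! ## §1 Algebra: the radial field in coordinates, homogeneity of `det`, the coordinate bounds, the divisor `D = (x₀₀ + ip)⁻¹` -/

/-- The chart matrix decomposed along the four Lebesgue directions `e_a, e_u, e_v, e_b`:
`hermTwo (a, z, b) = a·E_a + (re z)·E_u + (im z)·E_v + b·E_b`. [folklore] -/
theorem hermTwo_decomp (c : ℝ × ℂ × ℝ) :
    hermTwo c = (c.1 : ℂ) • hermTwo ((1 : ℝ), (0 : ℂ), (0 : ℝ)) + (c.2.1.re : ℂ) • hermTwo ((0 : ℝ), (1 : ℂ), (0 : ℝ)) +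
      (c.2.1.im : ℂ) • hermTwo ((0 : ℝ), I, (0 : ℝ)) + (c.2.2 : ℂ) • hermTwo ((0 : ℝ), (0 : ℂ), (1 : ℝ)) := by
  rw [hermTwo_dir_a, hermTwo_dir_u, hermTwo_dir_v, hermTwo_dir_b]
  ext i j
  fin_cases i <;> fin_cases j <;> apply Complex.ext <;> simp [hermTwo]

/-- **THE RADIAL FIELD IS THE COORDINATE COMBINATION OF THE FOUR DIRECTIONS**, traced against any `A`:
`tr(A·x) = a·tr(A·E_a) + re z·tr(A·E_u) + im z·tr(A·E_v) + b·tr(A·E_b)`. [folklore] -/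
theorem trace_mul_hermTwo_decomp (A : Matrix (Fin 2) (Fin 2) ℂ) (c : ℝ × ℂ × ℝ) :
    (A * hermTwo c).trace = (c.1 : ℂ) * (A * hermTwo ((1 : ℝ), (0 : ℂ), (0 : ℝ))).trace + (c.2.1.re : ℂ) * (A * hermTwo ((0 : ℝ), (1 : ℂ), (0 : ℝ))).trace +
      (c.2.1.im : ℂ) * (A * hermTwo ((0 : ℝ), I, (0 : ℝ))).trace + (c.2.2 : ℂ) * (A * hermTwo ((0 : ℝ), (0 : ℂ), (1 : ℝ))).trace := by
  conv_lhs => rw [hermTwo_decomp c]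
  simp only [Matrix.mul_add, Matrix.mul_smul, Matrix.trace_add, Matrix.trace_smul, smul_eq_mul]

/-- The point as the coordinate combination of the four directions in `ℝ × ℂ × ℝ`. [folklore] -/
theorem coord_decomp (c : ℝ × ℂ × ℝ) :
    c = c.1 • ((1 : ℝ), (0 : ℂ), (0 : ℝ)) + c.2.1.re • ((0 : ℝ), (1 : ℂ), (0 : ℝ)) + c.2.1.im • ((0 : ℝ), I, (0 : ℝ)) + c.2.2 • ((0 : ℝ), (0 : ℂ), (1 : ℝ)) := by
  obtain ⟨a, z, b⟩ := c
  refine Prod.ext ?_ (Prod.ext ?_ ?_) <;> simp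

/-- **HOMOGENEITY OF `det`, FIRST FORM**: `tr(adj(g − ix)·x) = −i·(tr(adj(g − ix)·g) − 2·det(g − ix))` (from `x = −i(g − Y)`, `adj(Y)Y = det Y`). [folklore] -/
theorem trace_adjugate_sub_mul_chart (g : Matrix (Fin 2) (Fin 2) ℂ) (c : ℝ × ℂ × ℝ) :
    ((g - I • hermTwo c).adjugate * hermTwo c).trace = -I * (((g - I • hermTwo c).adjugate * g).trace - 2 * (g - I • hermTwo c).det) := by
  have hX : (-I) • (g - (g - I • hermTwo c)) = hermTwo c := by
    rw [sub_sub_cancel, smul_smul]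
    simp
  have e : ((g - I • hermTwo c).adjugate * hermTwo c).trace = ((g - I • hermTwo c).adjugate * ((-I) • (g - (g - I • hermTwo c)))).trace := by
    rw [hX]
  rw [e, Matrix.mul_smul, Matrix.trace_smul, Matrix.mul_sub, Matrix.trace_sub, smul_eq_mul, Matrix.adjugate_mul, Matrix.trace_smul,
    Matrix.trace_one, Fintype.card_fin, smul_eq_mul]
  push_cast
  ring

/-- **HOMOGENEITY OF `det`, SECOND FORM**: `tr(adj(g + ix)·x) = −i·(2·det(g + ix) − tr(adj(g + ix)·g))`. [folklore] -/
theorem trace_adjugate_add_mul_chart (g : Matrix (Fin 2) (Fin 2) ℂ) (c : ℝ × ℂ × ℝ) :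
    ((g + I • hermTwo c).adjugate * hermTwo c).trace = -I * (2 * (g + I • hermTwo c).det - ((g + I • hermTwo c).adjugate * g).trace) := by
  have hX : (-I) • ((g + I • hermTwo c) - g) = hermTwo c := by
    rw [add_sub_cancel_left, smul_smul]
    simp
  have e : ((g + I • hermTwo c).adjugate * hermTwo c).trace = ((g + I • hermTwo c).adjugate * ((-I) • ((g + I • hermTwo c) - g))).trace := by
    rw [hX]
  rw [e, Matrix.mul_smul, Matrix.trace_smul, Matrix.mul_sub, Matrix.trace_sub, smul_eq_mul, Matrix.adjugate_mul, Matrix.trace_smul,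
    Matrix.trace_one, Fintype.card_fin, smul_eq_mul]
  push_cast
  ring

/-- The rank-one phase is the first coordinate: `tr(hermTwo(t,0,0)·x) = t·x₀₀`. [folklore] -/
theorem trace_rankOne_mul_hermTwo (t : ℝ) (c : ℝ × ℂ × ℝ) : (hermTwo (t, 0, 0) * hermTwo c).trace = (t : ℂ) * (c.1 : ℂ) := by
  rw [trace_hermTwo_mul_hermTwo]
  push_cast
  simp

/-- **THE COORDINATES ARE DOMINATED BY `|det(g + ix)|`** (`g > 0`): `∃ Cx ≥ 0, ∀ x k l, ‖x_{kl}‖ ≤ Cx·|det(g + ix)|` (entry bound ★ `exists_norm_entry_le_add`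
and `det g ≤ |det(g + ix)|` ★ `det_le_norm_det_add_I_smul`). [folklore] -/
theorem exists_norm_hermTwo_apply_le {g : Matrix (Fin 2) (Fin 2) ℂ} (hg : g.PosDef) :
    ∃ Cx : ℝ, 0 ≤ Cx ∧ ∀ (c : ℝ × ℂ × ℝ) (k l : Fin 2), ‖hermTwo c k l‖ ≤ Cx * ‖(g + I • hermTwo c).det‖ := by
  obtain ⟨C, hC, hle⟩ := exists_norm_entry_le_add hg
  have hδ := det_re_pos_of_posDef hg
  obtain ⟨δ, hδdef⟩ : ∃ δ : ℝ, δ = (g 0 0).re * (g 1 1).re - normSq (g 0 1) := ⟨_, rfl⟩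
  rw [← hδdef] at hδ
  obtain ⟨Mg, hMg⟩ : ∃ Mg : ℝ, Mg = ‖g 0 0‖ + ‖g 0 1‖ + ‖g 1 0‖ + ‖g 1 1‖ := ⟨_, rfl⟩
  have hMg0 : 0 ≤ Mg := by rw [hMg]; positivity
  refine ⟨C + Mg / δ, add_nonneg hC.le (div_nonneg hMg0 hδ.le), fun c k l => ?_⟩
  have hD : δ ≤ ‖(g + I • hermTwo c).det‖ := hδdef ▸ det_le_norm_det_add_I_smul hg c
  have hgkl : ‖g k l‖ ≤ Mg := by
    fin_cases k <;> fin_cases l <;> simp only [Fin.zero_eta, Fin.mk_one] <;>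
      linarith [hMg, norm_nonneg (g 0 0), norm_nonneg (g 0 1), norm_nonneg (g 1 0), norm_nonneg (g 1 1)]
  have hx : hermTwo c k l = -I * ((g + I • hermTwo c) k l - g k l) := by
    simp only [Matrix.add_apply, Matrix.smul_apply, smul_eq_mul]
    ring_nf
    simp only [Complex.I_sq]
    ring
  have h1 : ‖hermTwo c k l‖ ≤ ‖(g + I • hermTwo c) k l‖ + ‖g k l‖ := by
    rw [hx, norm_mul, norm_neg, Complex.norm_I, one_mul]
    exact norm_sub_le _ _
  have h2 : ‖g k l‖ ≤ Mg / δ * ‖(g + I • hermTwo c).det‖ := by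
    rw [div_mul_eq_mul_div, le_div_iff₀ hδ]
    exact mul_le_mul hgkl hD hδ.le hMg0
  calc ‖hermTwo c k l‖ ≤ ‖(g + I • hermTwo c) k l‖ + ‖g k l‖ := h1
    _ ≤ C * ‖(g + I • hermTwo c).det‖ + Mg / δ * ‖(g + I • hermTwo c).det‖ := add_le_add (hle c k l) h2
    _ = (C + Mg / δ) * ‖(g + I • hermTwo c).det‖ := by ring

/-- The four Lebesgue coordinates are dominated by `Cx·|det(g + ix)|`. [folklore] -/
theorem norm_coords_le {g : Matrix (Fin 2) (Fin 2) ℂ} {Cx : ℝ} (hCx : ∀ (c : ℝ × ℂ × ℝ) (k l : Fin 2), ‖hermTwo c k l‖ ≤ Cx * ‖(g + I • hermTwo c).det‖)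
    (c : ℝ × ℂ × ℝ) :
    ‖(c.1 : ℂ)‖ ≤ Cx * ‖(g + I • hermTwo c).det‖ ∧ ‖(c.2.1.re : ℂ)‖ ≤ Cx * ‖(g + I • hermTwo c).det‖ ∧
      ‖(c.2.1.im : ℂ)‖ ≤ Cx * ‖(g + I • hermTwo c).det‖ ∧ ‖(c.2.2 : ℂ)‖ ≤ Cx * ‖(g + I • hermTwo c).det‖ := by
  have h00 := hCx c 0 0
  have h01 := hCx c 0 1
  have h11 := hCx c 1 1
  simp only [hermTwo_apply_zero_zero, hermTwo_apply_zero_one, hermTwo_apply_one_one] at h00 h01 h11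
  refine ⟨h00, ?_, ?_, h11⟩
  · rw [Complex.norm_real]
    exact (Complex.abs_re_le_norm _).trans h01
  · rw [Complex.norm_real]
    exact (Complex.abs_im_le_norm _).trans h01

/-- **THE DIVISOR** `D(x) = (x₀₀ + ip)⁻¹`: its norm is the gain factor `(x₀₀² + p²)^{−1/2}` (`p ≠ 0`). [folklore] -/
theorem norm_divisor (a : ℝ) {p : ℝ} (hp : 0 < p) : ‖((a : ℂ) + I * (p : ℂ))⁻¹‖ = (a ^ 2 + p ^ 2) ^ (-(1 / 2 : ℝ)) := by
  have hn : ‖(a : ℂ) + I * (p : ℂ)‖ = Real.sqrt (a ^ 2 + p ^ 2) := by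
    rw [Complex.norm_def, Complex.normSq_apply]
    congr 1
    simp
    ring
  rw [norm_inv, hn, Real.sqrt_eq_rpow, ← Real.rpow_neg (by positivity)]

/-- `x₀₀ + ip ≠ 0` for `p ≠ 0`. [folklore] -/
theorem coord_add_I_mul_ne_zero (a : ℝ) {p : ℝ} (hp : 0 < p) : (a : ℂ) + I * (p : ℂ) ≠ 0 := by
  intro h
  have := congrArg Complex.im h
  simp at this
  exact hp.ne' this

/-- `‖D(x)‖ ≤ 1∕p`. [folklore] -/
theorem norm_divisor_le (a : ℝ) {p : ℝ} (hp : 0 < p) : ‖((a : ℂ) + I * (p : ℂ))⁻¹‖ ≤ p⁻¹ := by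
  rw [norm_inv]
  refine inv_anti₀ hp ?_
  calc p = |((a : ℂ) + I * (p : ℂ)).im| := by simp [abs_of_pos hp]
    _ ≤ ‖(a : ℂ) + I * (p : ℂ)‖ := Complex.abs_im_le_norm _

/-- `x₀₀·D(x) = 1 − ip·D(x)` and `‖x₀₀·D(x)‖ ≤ 1`. [folklore] -/
theorem coord_mul_divisor (a : ℝ) {p : ℝ} (hp : 0 < p) :
    (a : ℂ) * ((a : ℂ) + I * (p : ℂ))⁻¹ = 1 - I * (p : ℂ) * ((a : ℂ) + I * (p : ℂ))⁻¹ ∧ ‖(a : ℂ) * ((a : ℂ) + I * (p : ℂ))⁻¹‖ ≤ 1 := by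
  have hne := coord_add_I_mul_ne_zero a hp
  constructor
  · have : ((a : ℂ) + I * (p : ℂ)) * ((a : ℂ) + I * (p : ℂ))⁻¹ = 1 := mul_inv_cancel₀ hne
    linear_combination this
  · rw [norm_mul, norm_inv]
    refine mul_inv_le_one_of_le₀ ?_ (norm_nonneg _)
    calc ‖(a : ℂ)‖ = |((a : ℂ) + I * (p : ℂ)).re| := by simp
      _ ≤ ‖(a : ℂ) + I * (p : ℂ)‖ := Complex.abs_re_le_norm _

/-- **LINE DERIVATIVE OF THE DIVISOR**: `D_v (x₀₀ + ip)⁻¹ = −v₁·(x₀₀ + ip)⁻²`. [folklore] -/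
theorem hasLineDerivAt_divisor {p : ℝ} (hp : 0 < p) (c v : ℝ × ℂ × ℝ) :
    HasLineDerivAt ℝ (fun c : ℝ × ℂ × ℝ => ((c.1 : ℂ) + I * (p : ℂ))⁻¹) (-(v.1 : ℂ) * (((c.1 : ℂ) + I * (p : ℂ))⁻¹) ^ 2) c v := by
  show HasDerivAt (fun τ : ℝ => (((c + τ • v).1 : ℂ) + I * (p : ℂ))⁻¹) _ 0
  have hlin : ∀ τ : ℝ, (((c + τ • v).1 : ℝ) : ℂ) + I * (p : ℂ) = ((c.1 : ℂ) + I * (p : ℂ)) + (τ : ℂ) * (v.1 : ℂ) := by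
    intro τ
    simp only [Prod.fst_add, Prod.smul_fst, smul_eq_mul, Complex.ofReal_add, Complex.ofReal_mul]
    ring
  simp_rw [hlin]
  have hne : ((c.1 : ℂ) + I * (p : ℂ)) + ((0 : ℝ) : ℂ) * (v.1 : ℂ) ≠ 0 := by
    rw [Complex.ofReal_zero, zero_mul, add_zero]
    exact coord_add_I_mul_ne_zero c.1 hp
  have h0 : HasDerivAt (fun τ : ℝ => ((c.1 : ℂ) + I * (p : ℂ)) + (τ : ℂ) * (v.1 : ℂ)) ((1 : ℂ) * (v.1 : ℂ)) 0 :=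
    ((show HasDerivAt (fun s : ℝ => (s : ℂ)) 1 0 by simpa using (hasDerivAt_id (0 : ℝ)).ofReal_comp).mul_const _).const_add _
  have h1 := (hasDerivAt_inv hne).comp (0 : ℝ) h0
  rw [Complex.ofReal_zero, zero_mul, add_zero] at h1
  refine h1.congr_deriv ?_
  field_simp

/-! ## §2 The full integrand's line derivative and its relative bound -/

/-- **LINE DERIVATIVE OF THE ξ-INTEGRAND WITH CHARACTER** (`g > 0`, any `h`):
`D_v ξ-int(α,β) = −2πi·tr(h·E_v)·ξ-int(α,β) − iα·tr(adj(g−ix)E_v)·ξ-int(α+1,β) + iβ·tr(adj(g+ix)E_v)·ξ-int(α,β+1)`. [cite: Shimura1982, §3] -/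
theorem hasLineDerivAt_xiTwoIntegrand {g : Matrix (Fin 2) (Fin 2) ℂ} (hg : g.PosDef) (h : Matrix (Fin 2) (Fin 2) ℂ) (α β : ℂ) (c v : ℝ × ℂ × ℝ) :
    HasLineDerivAt ℝ (xiTwoIntegrand g h α β)
      (-(2 * Real.pi * I) * (h * hermTwo v).trace * xiTwoIntegrand g h α β c +
        (-(I * α) * (((g - I • hermTwo c).adjugate * hermTwo v).trace * xiTwoIntegrand g h (α + 1) β c) +
          I * β * (((g + I • hermTwo c).adjugate * hermTwo v).trace * xiTwoIntegrand g h α (β + 1) c))) c v := by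
  have hfun : xiTwoIntegrand g h α β = fun c => cexp (-(2 * Real.pi * I) * (h * hermTwo c).trace) * xiTwoIntegrand g 0 α β c :=
    funext fun c => xiTwoIntegrand_eq_cexp_mul_zero g h α β c
  rw [hfun]
  have h1 : HasDerivAt (fun τ : ℝ => cexp (-(2 * Real.pi * I) * (h * hermTwo (c + τ • v)).trace))
      (-(2 * Real.pi * I) * (h * hermTwo v).trace * cexp (-(2 * Real.pi * I) * (h * hermTwo c).trace)) 0 := hasLineDerivAt_cexp_trace h c v
  have h2 : HasDerivAt (fun τ : ℝ => xiTwoIntegrand g 0 α β (c + τ • v))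
      (-(I * α * ((g - I • hermTwo c).adjugate * hermTwo v).trace) * xiTwoIntegrand g 0 (α + 1) β c +
        I * β * ((g + I • hermTwo c).adjugate * hermTwo v).trace * xiTwoIntegrand g 0 α (β + 1) c) 0 := hasLineDerivAt_xiTwoIntegrand_zero hg α β c v
  have h3 := h1.mul h2
  show HasDerivAt (fun τ : ℝ => cexp (-(2 * Real.pi * I) * (h * hermTwo (c + τ • v)).trace) * xiTwoIntegrand g 0 α β (c + τ • v)) _ 0
  refine h3.congr_deriv ?_
  simp only [zero_smul, add_zero]
  rw [xiTwoIntegrand_eq_cexp_mul_zero g h (α + 1) β c, xiTwoIntegrand_eq_cexp_mul_zero g h α (β + 1) c]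
  ring

/-- **THE RELATIVE BOUND ON THE LINE DERIVATIVE** (`g > 0`, `h` Hermitian): `‖D_v ξ-int(α,β)(x)‖ ≤ CΦ·‖ξ-int(α,β)(x)‖` with `CΦ` independent of `x`
(index shifts cost `|det|⁻¹`, polarisations pay `|det|`: ★ `norm_xiTwoIntegrand_succ_left∕right`, ★ `exists_norm_entry_le_sub∕add`). [cite: Shimura1982, §3] -/
theorem exists_norm_lineDeriv_xiTwoIntegrand_le {g : Matrix (Fin 2) (Fin 2) ℂ} (hg : g.PosDef) (h : Matrix (Fin 2) (Fin 2) ℂ) (α β : ℂ) (v : ℝ × ℂ × ℝ) :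
    ∃ CΦ : ℝ, 0 ≤ CΦ ∧ ∀ c : ℝ × ℂ × ℝ,
      ‖-(2 * Real.pi * I) * (h * hermTwo v).trace * xiTwoIntegrand g h α β c +
        (-(I * α) * (((g - I • hermTwo c).adjugate * hermTwo v).trace * xiTwoIntegrand g h (α + 1) β c) +
          I * β * (((g + I • hermTwo c).adjugate * hermTwo v).trace * xiTwoIntegrand g h α (β + 1) c))‖ ≤ CΦ * ‖xiTwoIntegrand g h α β c‖ := by
  obtain ⟨C₁, hC₁, hle₁⟩ := exists_norm_entry_le_sub hg
  obtain ⟨C₂, hC₂, hle₂⟩ := exists_norm_entry_le_add hg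
  set S : ℝ := ‖hermTwo v 0 0‖ + ‖hermTwo v 0 1‖ + ‖hermTwo v 1 0‖ + ‖hermTwo v 1 1‖ with hS
  have hS0 : 0 ≤ S := by positivity
  refine ⟨2 * Real.pi * ‖(h * hermTwo v).trace‖ + ‖α‖ * (C₁ * S) + ‖β‖ * (C₂ * S), by positivity, fun c => ?_⟩
  have hP : 0 < ‖(g - I • hermTwo c).det‖ := norm_pos_iff.mpr (det_sub_I_smul_hermTwo_ne_zero hg c)
  have hQ : 0 < ‖(g + I • hermTwo c).det‖ := norm_det_add_I_smul_pos hg c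
  have hpolY := norm_trace_adjugate_mul_le (g - I • hermTwo c) (hermTwo v) (fun i j => hle₁ c i j)
  have hpolW := norm_trace_adjugate_mul_le (g + I • hermTwo c) (hermTwo v) (fun i j => hle₂ c i j)
  rw [← hS] at hpolY hpolW
  set Φ := ‖xiTwoIntegrand g h α β c‖ with hΦ
  have hΦ0 : 0 ≤ Φ := norm_nonneg _
  -- the three terms
  have t1 : ‖-(2 * Real.pi * I) * (h * hermTwo v).trace * xiTwoIntegrand g h α β c‖ = 2 * Real.pi * ‖(h * hermTwo v).trace‖ * Φ := by
    rw [norm_mul, norm_mul, norm_neg, norm_mul, Complex.norm_I, mul_one, norm_mul, Complex.norm_ofNat, Complex.norm_real,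
      Real.norm_of_nonneg Real.pi_pos.le, ← hΦ]
  have t2 : ‖-(I * α) * (((g - I • hermTwo c).adjugate * hermTwo v).trace * xiTwoIntegrand g h (α + 1) β c)‖ ≤ ‖α‖ * (C₁ * S) * Φ := by
    rw [norm_mul, norm_neg, norm_mul, Complex.norm_I, one_mul, norm_mul, norm_xiTwoIntegrand_succ_left hg, ← hΦ]
    calc ‖α‖ * (‖((g - I • hermTwo c).adjugate * hermTwo v).trace‖ * (‖(g - I • hermTwo c).det‖⁻¹ * Φ))
        ≤ ‖α‖ * ((C₁ * ‖(g - I • hermTwo c).det‖ * S) * (‖(g - I • hermTwo c).det‖⁻¹ * Φ)) :=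
          mul_le_mul_of_nonneg_left (mul_le_mul_of_nonneg_right hpolY (by positivity)) (norm_nonneg _)
      _ = ‖α‖ * (C₁ * S) * Φ := by field_simp
  have t3 : ‖I * β * (((g + I • hermTwo c).adjugate * hermTwo v).trace * xiTwoIntegrand g h α (β + 1) c)‖ ≤ ‖β‖ * (C₂ * S) * Φ := by
    rw [norm_mul, norm_mul, Complex.norm_I, one_mul, norm_mul, norm_xiTwoIntegrand_succ_right hg, ← hΦ]
    calc ‖β‖ * (‖((g + I • hermTwo c).adjugate * hermTwo v).trace‖ * (‖(g + I • hermTwo c).det‖⁻¹ * Φ))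
        ≤ ‖β‖ * ((C₂ * ‖(g + I • hermTwo c).det‖ * S) * (‖(g + I • hermTwo c).det‖⁻¹ * Φ)) :=
          mul_le_mul_of_nonneg_left (mul_le_mul_of_nonneg_right hpolW (by positivity)) (norm_nonneg _)
      _ = ‖β‖ * (C₂ * S) * Φ := by field_simp
  calc _ ≤ ‖-(2 * Real.pi * I) * (h * hermTwo v).trace * xiTwoIntegrand g h α β c‖ +
        ‖-(I * α) * (((g - I • hermTwo c).adjugate * hermTwo v).trace * xiTwoIntegrand g h (α + 1) β c) +
          I * β * (((g + I • hermTwo c).adjugate * hermTwo v).trace * xiTwoIntegrand g h α (β + 1) c)‖ := norm_add_le _ _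
    _ ≤ ‖-(2 * Real.pi * I) * (h * hermTwo v).trace * xiTwoIntegrand g h α β c‖ +
        (‖-(I * α) * (((g - I • hermTwo c).adjugate * hermTwo v).trace * xiTwoIntegrand g h (α + 1) β c)‖ +
          ‖I * β * (((g + I • hermTwo c).adjugate * hermTwo v).trace * xiTwoIntegrand g h α (β + 1) c)‖) := by
        gcongr
        exact norm_add_le _ _
    _ ≤ 2 * Real.pi * ‖(h * hermTwo v).trace‖ * Φ + (‖α‖ * (C₁ * S) * Φ + ‖β‖ * (C₂ * S) * Φ) := by
        rw [t1]
        exact add_le_add le_rfl (add_le_add t2 t3)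
    _ = (2 * Real.pi * ‖(h * hermTwo v).trace‖ + ‖α‖ * (C₁ * S) + ‖β‖ * (C₂ * S)) * Φ := by ring

end Summit.HodgeConjecture.HodgeConjecture.Cruxes.HLiu418.K2LiuHermTwoXiEulerCalculus

end
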